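import Summits.QuantumFields.BalabanUV.T4Continuum.Support.NE7LatticeLandauEuler
import HarnessLib

/-!
# NE7 — THE TRACE-LINK MINIMISING GAUGE ON A FINITE SET OF SITES (a cube) AND ITS EULER–LAGRANGE EQUATION: THE LATTICE LANDAU CONDITION `div_Q sinh A = 0`
# AT EVERY SITE OF THE SET — the Neumann-type local Landau gauge ROAD (U) (B2) starts from (F304)

Cell `pub-balaban`, rung (B)+1 sub-cell t4, lineage `b2b-balaban-t4-ne7-p1` (CRUX PROVER NE7 #1 = OWNER of row NE7), generation 92; memo
`t4/b2b-balaban-t4-ne7-p1-g92/LOG-OBSTRUCTION.md` §4.  The CUBE twin of lineage #2's (161a) `NE7LatticeLandauMinimiser.exists_traceLinkMinimiser` and (161b)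
`NE7LatticeLandauEuler.landau_of_isMin` (torus versions), over their kit (`nReTr_skew_eq_zero`, `HSMat`, `expGauge`, `hasDerivAt_exp_smul_zero`).

WHY.  F303 `NE7CubeGradientLandauEL` derives the cube chart's gradient letter from its SUP letter when the chart's gauge satisfies the lattice Landau condition in
Euler–Lagrange form `Σ_κ [(W(y,κ) − W(y,κ)†) − (W(y−e_κ,κ) − W(y−e_κ,κ)†)] = 0` at the interior sites.  Such a gauge EXISTS on every finite set of sites `Q`, for every
configuration `U`, with no smallness: minimise the smooth trace-link functional `Σ_{x ∈ B} Σ_κ (1 − Re tr U^{g}(x,κ))` (`B` any finite set of base sites carrying every bond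
that touches `Q`) over the site gauges `g` that are unitary on `Q` and `1` off `Q` (a compact set), and differentiate along `g_t = e^{tX·δ_y}·g` for `y ∈ Q` and skew `X`
(Fermat; `Re tr(X·D) = 0` for all skew `X` forces `D − D† = 0`).  Unlike the torus there is NO pinned class: the condition holds at EVERY `y ∈ Q` whose backward
neighbours are based in `B` — in particular at every interior site, with the natural Neumann behaviour at the boundary built in.  What ROAD (U) (B2) must add is the SUP
LETTER `‖log U^{g}‖ ≤ K·ℓ·r∕M` of this minimiser in the small-curvature regime `ℓ²r ≪ 1` (memo §4); with it F303 and F302's pattern give the chart input of route 1.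
WHAT ([folklore]; 0 def, 0 sorry).  §1 `extC` bookkeeping as local `have`s only (no def): **`exists_cubeTraceLinkMinimiser`** (the minimiser over {unitary on `Q`, `1`
off `Q`}).  §2 `hasDerivAt_traceLink_expGauge_finset` (first variation over an arbitrary finite set of base sites).  §3 **`landau_of_isMin_cube`** (Euler–Lagrange at
every `y ∈ Q` with `y ∈ B`, `y − e_κ ∈ B`).  §4 **`exists_cubeLandauGauge`**.
HONEST FRAMING (page 1): elementary finite-dimensional analysis of OUR objects; the SUP letter of the minimiser is NOT claimed; nothing of Bałaban's asserted; NE7 NOT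
PROVED; spine 0∕9; finite T⁴ rung (B)+1 — NOT infinite volume, NOT mass gap, NOT `BetaPertH`, NOT Clay.  Continuum YM on T⁴ ⇐ BetaPertH ∧ nine spine estimates (0/9
proved); BetaPertH ⇐ (D1) ∧ (D4) ∧ CAP+tail; G-an2-4 gates asym, D1 and NE2/3/4.  No `sorry`; axioms ⊆ {propext, Classical.choice, Quot.sound}.
-/

set_option autoImplicit false

open scoped BigOperators Matrix Matrix.Norms.L2Operator
open NormedSpace Finset

namespace Summit.QuantumFields.BalabanUV.T4Continuum.NE7CubeLandauMinimiser

open Literature.MathematicalPhysics.QuantumFieldTheory.Balaban1983to89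
open B7Prop1Explicit B7Prop2Explicit MatrixNorms UnitaryModel
open T4AveragingDeficitWall (nReTrL nReTrL_apply hasDerivAt_exp_smul_zero hasDerivAt_exp_neg_smul_zero)
open NE3HilbertSchmidtTorus (HSMat)
open NE3HilbertSchmidtTorus.HSMat (toHS ofHS ofHS_add ofHS_smul ofHS_toHS)
open NE7LinkFunctionalMinimiser (norm_sq_le_one_of_unitary)
open BlockAveragePushDirGauge (expGauge expGauge_zero val_gaugeAct_expGauge gaugeAct_const_one)
open B8Eq115GaugeFixing (gaugeAct_mul)
open NE7LatticeLandauMinimiser (nReTr_skew_eq_zero)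

noncomputable section

variable {d : ℕ} {n : Type*} [Fintype n] [DecidableEq n]

/-! ## §1 The trace link functional attains its minimum over {unitary on `Q`, `1` off `Q`} -/

set_option maxHeartbeats 800000 in
/-- **THE TRACE LINK FUNCTIONAL ATTAINS ITS MINIMUM OVER THE GAUGES SUPPORTED ON A FINITE SET.**  For finite sets of sites `B` (base points of the bonds counted) and `Q`
(where the gauge may differ from `1`) and any configuration `U`: there is a site gauge `u`, unitary everywhere and `= 1` off `Q`, with
`Σ_{x ∈ B} Σ_κ (1 − Re tr U^{u}(x,κ)) ≤` the same for every competitor of that class (compactness of `U(n)^{Q}`). [folklore] -/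
theorem exists_cubeTraceLinkMinimiser [Nonempty n] (B Q : Finset (Site d)) (U : Site d → Fin d → (Matrix n n ℂ)ˣ) :
    ∃ u : Site d → (Matrix n n ℂ)ˣ, (∀ x, u x ∈ unitaryUnits (Matrix n n ℂ)) ∧ (∀ x, x ∉ Q → u x = 1) ∧
      ∀ v : Site d → (Matrix n n ℂ)ˣ, (∀ x, v x ∈ unitaryUnits (Matrix n n ℂ)) → (∀ x, x ∉ Q → v x = 1) →
        ∑ x ∈ B, ∑ κ : Fin d, (1 - nReTr ((gaugeAct u U x κ : (Matrix n n ℂ)ˣ) : Matrix n n ℂ))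
          ≤ ∑ x ∈ B, ∑ κ : Fin d, (1 - nReTr ((gaugeAct v U x κ : (Matrix n n ℂ)ˣ) : Matrix n n ℂ)) := by
  classical
  letI : CStarAlgebra (Matrix n n ℂ) := {}
  -- the parameter space: one Hilbert–Schmidt matrix per site of `Q`
  let S : Type _ := PiLp 2 (fun _ : ↥Q => HSMat n)
  let ext : S → Site d → Matrix n n ℂ := fun a x => if h : x ∈ Q then ofHS (a ⟨x, h⟩) else 1
  have hext_cont : ∀ x : Site d, Continuous fun a : S => ext a x := by
    intro x
    by_cases h : x ∈ Q
    · let f : HSMat n →ₗ[ℝ] Matrix n n ℂ := { toFun := ofHS, map_add' := ofHS_add, map_smul' := ofHS_smul }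
      have hf : Continuous f := f.continuous_of_finiteDimensional
      have : (fun a : S => ext a x) = fun a : S => f (a ⟨x, h⟩) := by funext a; simp only [ext, dif_pos h]; rfl
      rw [this]
      exact hf.comp (PiLp.continuous_apply 2 _ (⟨x, h⟩ : ↥Q))
    · have : (fun a : S => ext a x) = fun _ => 1 := by funext a; simp only [ext, dif_neg h]
      rw [this]; exact continuous_const
  let Φ : S → ℝ := fun a =>
    ∑ x ∈ B, ∑ κ : Fin d, (1 - nReTr (ext a x * ((U x κ : (Matrix n n ℂ)ˣ) : Matrix n n ℂ) * star (ext a (x + e κ))))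
  have hΦ : Continuous Φ := by
    refine continuous_finsetSum _ fun x _ => continuous_finsetSum _ fun κ _ => continuous_const.sub ?_
    exact continuous_nReTr.comp (((hext_cont x).mul continuous_const).mul (hext_cont (x + e κ)).star)
  -- the constraint set: unitary values on `Q`
  let K : Set S := {a | ∀ s : ↥Q, ofHS (a s) ∈ unitary (Matrix n n ℂ)}
  have hKclosed : IsClosed K := by
    have hK : K = ⋂ s : ↥Q, {a : S | ofHS (a s) ∈ unitary (Matrix n n ℂ)} := by
      ext a; simp only [K, Set.mem_setOf_eq, Set.mem_iInter]
    rw [hK]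
    refine isClosed_iInter fun s => isClosed_unitary.preimage ?_
    have h := hext_cont (s : Site d)
    have e : (fun a : S => ext a (s : Site d)) = fun a : S => ofHS (a s) := by
      funext a; simp only [ext, dif_pos s.2]
    rwa [e] at h
  have hKbdd : Bornology.IsBounded K := by
    rw [isBounded_iff_forall_norm_le]
    refine ⟨Real.sqrt (Fintype.card ↥Q), fun a ha => ?_⟩
    rw [PiLp.norm_eq_of_L2]
    refine Real.sqrt_le_sqrt ?_
    calc ∑ s : ↥Q, ‖a s‖ ^ 2 ≤ ∑ _s : ↥Q, (1 : ℝ) := Finset.sum_le_sum fun s _ => norm_sq_le_one_of_unitary (ha s)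
      _ = Fintype.card ↥Q := by rw [Finset.sum_const, Finset.card_univ, nsmul_eq_mul, mul_one]
  have hKc : IsCompact K := Metric.isCompact_of_isClosed_isBounded hKclosed hKbdd
  -- the flat gauge lies in `K`
  let a₁ : S := (WithLp.equiv 2 _).symm fun _ => toHS (1 : Matrix n n ℂ)
  have ha₁ : ∀ s : ↥Q, a₁ s = toHS (1 : Matrix n n ℂ) := fun s => rfl
  have hK1 : a₁ ∈ K := fun s => by rw [ha₁, ofHS_toHS]; exact (unitary (Matrix n n ℂ)).one_mem
  obtain ⟨a₀, ha₀K, hmin⟩ := hKc.exists_isMinOn ⟨_, hK1⟩ hΦ.continuousOn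
  -- the minimising gauge
  have hext_unit : ∀ x, ext a₀ x ∈ unitary (Matrix n n ℂ) := by
    intro x
    by_cases h : x ∈ Q
    · simp only [ext, dif_pos h]; exact ha₀K ⟨x, h⟩
    · simp only [ext, dif_neg h]; exact (unitary (Matrix n n ℂ)).one_mem
  let u : Site d → (Matrix n n ℂ)ˣ := fun x =>
    ⟨ext a₀ x, star (ext a₀ x), Unitary.mul_star_self_of_mem (hext_unit x), Unitary.star_mul_self_of_mem (hext_unit x)⟩
  have hu_val : ∀ x, ((u x : (Matrix n n ℂ)ˣ) : Matrix n n ℂ) = ext a₀ x := fun _ => rfl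
  have hu_inv : ∀ x, (((u x)⁻¹ : (Matrix n n ℂ)ˣ) : Matrix n n ℂ) = star (ext a₀ x) := fun _ => rfl
  refine ⟨u, fun x => mem_unitaryUnits.mpr (hext_unit x), fun x hx => Units.ext ?_, fun v hvu hvQ => ?_⟩
  · rw [hu_val, Units.val_one]; simp only [ext, dif_neg hx]
  -- a competitor `v` of the class gives a point of `K`
  let av : S := (WithLp.equiv 2 _).symm fun s => toHS ((v (s : Site d) : (Matrix n n ℂ)ˣ) : Matrix n n ℂ)
  have hav : ∀ s : ↥Q, av s = toHS ((v (s : Site d) : (Matrix n n ℂ)ˣ) : Matrix n n ℂ) := fun s => rfl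
  have hext_v : ∀ x, ext av x = ((v x : (Matrix n n ℂ)ˣ) : Matrix n n ℂ) := by
    intro x
    by_cases h : x ∈ Q
    · simp only [ext, dif_pos h, hav, ofHS_toHS]
    · simp only [ext, dif_neg h, hvQ x h, Units.val_one]
  have havK : av ∈ K := fun s => by rw [hav, ofHS_toHS]; exact mem_unitaryUnits.mp (hvu _)
  have hle := hmin havK
  have hΦu : Φ a₀ = ∑ x ∈ B, ∑ κ : Fin d, (1 - nReTr ((gaugeAct u U x κ : (Matrix n n ℂ)ˣ) : Matrix n n ℂ)) := by
    refine Finset.sum_congr rfl fun x _ => Finset.sum_congr rfl fun κ _ => ?_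
    rw [show ((gaugeAct u U x κ : (Matrix n n ℂ)ˣ) : Matrix n n ℂ) = ext a₀ x * ((U x κ : (Matrix n n ℂ)ˣ) : Matrix n n ℂ) * star (ext a₀ (x + e κ)) by
      unfold gaugeAct; rw [Units.val_mul, Units.val_mul, hu_val, hu_inv]]
  have hΦv : Φ av = ∑ x ∈ B, ∑ κ : Fin d, (1 - nReTr ((gaugeAct v U x κ : (Matrix n n ℂ)ˣ) : Matrix n n ℂ)) := by
    refine Finset.sum_congr rfl fun x _ => Finset.sum_congr rfl fun κ _ => ?_
    rw [hext_v, hext_v]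
    rw [show ((gaugeAct v U x κ : (Matrix n n ℂ)ˣ) : Matrix n n ℂ)
        = ((v x : (Matrix n n ℂ)ˣ) : Matrix n n ℂ) * ((U x κ : (Matrix n n ℂ)ˣ) : Matrix n n ℂ) * star ((v (x + e κ) : (Matrix n n ℂ)ˣ) : Matrix n n ℂ) by
      unfold gaugeAct; rw [Units.val_mul, Units.val_mul, AveragingDeficitTransport.val_inv_eq_star_of_unitary (hvu _)]]
  have h := hle
  rw [Set.mem_setOf_eq, hΦu, hΦv] at h
  exact h

/-! ## §2 The first variation over a finite set of base sites -/

/-- **FIRST VARIATION OF THE TRACE LINK FUNCTIONAL ALONG `u_t = e^{tλ}·u`**, summed over an arbitrary finite set `B` of base sites: with `W = U^{u}`,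
`d∕dt|₀ Σ_{x ∈ B} Σ_κ (1 − Re tr W^{e^{tλ}}(x,κ)) = −Σ_{x ∈ B} Σ_κ Re tr(λ(x)W(x,κ) − W(x,κ)λ(x+e_κ))`. [folklore] -/
theorem hasDerivAt_traceLink_expGauge_finset [Nonempty n] (B : Finset (Site d)) (W : Site d → Fin d → (Matrix n n ℂ)ˣ) (lam : Site d → Matrix n n ℂ) :
    HasDerivAt (fun t : ℝ => ∑ x ∈ B, ∑ κ : Fin d,
        (1 - nReTr ((gaugeAct (expGauge lam t) W x κ : (Matrix n n ℂ)ˣ) : Matrix n n ℂ)))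
      (-(∑ x ∈ B, ∑ κ : Fin d,
        nReTr (lam x * ((W x κ : (Matrix n n ℂ)ˣ) : Matrix n n ℂ) - ((W x κ : (Matrix n n ℂ)ˣ) : Matrix n n ℂ) * lam (x + e κ)))) 0 := by
  have hterm : ∀ (x : Site d) (κ : Fin d), HasDerivAt (fun t : ℝ => (1 - nReTr ((gaugeAct (expGauge lam t) W x κ : (Matrix n n ℂ)ˣ) : Matrix n n ℂ)))
      (-(nReTr (lam x * ((W x κ : (Matrix n n ℂ)ˣ) : Matrix n n ℂ) - ((W x κ : (Matrix n n ℂ)ˣ) : Matrix n n ℂ) * lam (x + e κ)))) 0 := by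
    intro x κ
    have h1 := ((hasDerivAt_exp_smul_zero (lam x)).mul_const ((W x κ : (Matrix n n ℂ)ˣ) : Matrix n n ℂ)).mul
      (hasDerivAt_exp_neg_smul_zero (lam (x + e κ)))
    have h2 : HasDerivAt (fun t : ℝ => ((gaugeAct (expGauge lam t) W x κ : (Matrix n n ℂ)ˣ) : Matrix n n ℂ))
        (lam x * ((W x κ : (Matrix n n ℂ)ˣ) : Matrix n n ℂ) - ((W x κ : (Matrix n n ℂ)ˣ) : Matrix n n ℂ) * lam (x + e κ)) 0 := by
      have h3 : (fun t : ℝ => ((gaugeAct (expGauge lam t) W x κ : (Matrix n n ℂ)ˣ) : Matrix n n ℂ))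
          = fun t : ℝ => exp ((t : ℂ) • lam x) * ((W x κ : (Matrix n n ℂ)ˣ) : Matrix n n ℂ) * exp (-((t : ℂ) • lam (x + e κ))) := by
        funext t; exact val_gaugeAct_expGauge W lam t x κ
      rw [h3]
      refine h1.congr_deriv ?_
      simp only [Complex.ofReal_zero, zero_smul, neg_zero, exp_zero, one_mul, mul_one]
      noncomm_ring
    have h4 := ((nReTrL (n := n)).hasFDerivAt.comp_hasDerivAt (0 : ℝ) h2).const_sub 1
    simpa [Function.comp_def] using h4
  have hsum : HasDerivAt (fun t : ℝ => ∑ x ∈ B, ∑ κ : Fin d,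
        (1 - nReTr ((gaugeAct (expGauge lam t) W x κ : (Matrix n n ℂ)ˣ) : Matrix n n ℂ)))
      (∑ x ∈ B, ∑ κ : Fin d,
        -(nReTr (lam x * ((W x κ : (Matrix n n ℂ)ˣ) : Matrix n n ℂ) - ((W x κ : (Matrix n n ℂ)ˣ) : Matrix n n ℂ) * lam (x + e κ)))) 0 :=
    HasDerivAt.fun_sum fun x _ => HasDerivAt.fun_sum fun κ _ => hterm x κ
  refine hsum.congr_deriv ?_
  simp only [Finset.sum_neg_distrib]

/-! ## §3 The Euler–Lagrange equation: the lattice Landau condition at every site of `Q` -/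

set_option maxHeartbeats 800000 in
/-- **A MINIMISER OVER THE GAUGES SUPPORTED ON `Q` SATISFIES THE LATTICE LANDAU CONDITION AT EVERY SITE OF `Q` WHOSE BONDS ARE COUNTED**: for `u` unitary, `= 1`
off `Q`, minimising `Σ_{x ∈ B} Σ_κ (1 − Re tr U^{u}(x,κ))` over that class, with `W = U^{u}`: at every `y ∈ Q` with `y ∈ B` and `y − e_κ ∈ B` for all `κ`,
`Σ_κ [(W(y,κ) − W(y,κ)ᴴ) − (W(y−e_κ,κ) − W(y−e_κ,κ)ᴴ)] = 0` (Fermat along `e^{tX·δ_y}·u`, `X` skew, then `nReTr_skew_eq_zero`). [folklore] -/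
theorem landau_of_isMin_cube [Nonempty n] (B Q : Finset (Site d)) {U : Site d → Fin d → (Matrix n n ℂ)ˣ}
    {u : Site d → (Matrix n n ℂ)ˣ} (hu : ∀ x, u x ∈ unitaryUnits (Matrix n n ℂ)) (huQ : ∀ x, x ∉ Q → u x = 1)
    (hmin : ∀ v : Site d → (Matrix n n ℂ)ˣ, (∀ x, v x ∈ unitaryUnits (Matrix n n ℂ)) → (∀ x, x ∉ Q → v x = 1) →
        ∑ x ∈ B, ∑ κ : Fin d, (1 - nReTr ((gaugeAct u U x κ : (Matrix n n ℂ)ˣ) : Matrix n n ℂ))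
          ≤ ∑ x ∈ B, ∑ κ : Fin d, (1 - nReTr ((gaugeAct v U x κ : (Matrix n n ℂ)ˣ) : Matrix n n ℂ)))
    {y : Site d} (hyQ : y ∈ Q) (hyB : y ∈ B) (hyB' : ∀ κ : Fin d, y - e κ ∈ B) :
    ∑ κ : Fin d, ((((gaugeAct u U y κ : (Matrix n n ℂ)ˣ) : Matrix n n ℂ) - ((gaugeAct u U y κ : (Matrix n n ℂ)ˣ) : Matrix n n ℂ)ᴴ)
      - (((gaugeAct u U (y - e κ) κ : (Matrix n n ℂ)ˣ) : Matrix n n ℂ) - ((gaugeAct u U (y - e κ) κ : (Matrix n n ℂ)ˣ) : Matrix n n ℂ)ᴴ)) = 0 := by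
  classical
  set W : Site d → Fin d → (Matrix n n ℂ)ˣ := gaugeAct u U with hW
  set Dv : Matrix n n ℂ := ∑ κ : Fin d, (((W y κ : (Matrix n n ℂ)ˣ) : Matrix n n ℂ) - ((W (y - e κ) κ : (Matrix n n ℂ)ˣ) : Matrix n n ℂ)) with hDv
  -- `Re tr (X · Dv) = 0` for every skew `X`
  have hfree : ∀ X : Matrix n n ℂ, X ∈ skewAdjoint (Matrix n n ℂ) → nReTr (X * Dv) = 0 := by
    intro X hX
    -- the variation `λ = X` at `y`, `0` elsewhere
    let lam : Site d → Matrix n n ℂ := fun x => if x = y then X else 0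
    have hlam_skew : ∀ x, lam x ∈ skewAdjoint (Matrix n n ℂ) := by
      intro x; by_cases h : x = y
      · simp only [lam, h, if_true]; exact hX
      · simp only [lam, h, if_false]; exact (skewAdjoint (Matrix n n ℂ)).zero_mem
    have hlamQ : ∀ x, x ∉ Q → lam x = 0 := by
      intro x hx
      have : x ≠ y := fun h => hx (h ▸ hyQ)
      simp only [lam, this, if_false]
    -- the competitors `v_t = e^{tλ}·u`
    let v : ℝ → Site d → (Matrix n n ℂ)ˣ := fun t => expGauge lam t * u
    have hvu : ∀ t x, v t x ∈ unitaryUnits (Matrix n n ℂ) := by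
      intro t x
      have h1 : expGauge lam t x ∈ unitaryUnits (Matrix n n ℂ) := by
        rw [mem_unitaryUnits]
        have hskew : (t : ℂ) • lam x ∈ skewAdjoint (Matrix n n ℂ) := by rw [Complex.coe_smul]; exact skewAdjoint.smul_mem t (hlam_skew x)
        letI : NormedAlgebra ℚ (Matrix n n ℂ) := NormedAlgebra.restrictScalars ℚ ℝ (Matrix n n ℂ)
        exact NormedSpace.exp_mem_unitary_of_mem_skewAdjoint hskew
      exact (unitaryUnits (Matrix n n ℂ)).mul_mem h1 (hu x)
    have hvQ : ∀ t x, x ∉ Q → v t x = 1 := by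
      intro t x hx
      simp only [v, Pi.mul_apply, expGauge, hlamQ x hx, smul_zero, huQ x hx, mul_one]
      exact Units.ext (by simp)
    -- the function of `t` has a minimum at `0`
    have hlocmin : IsLocalMin (fun t : ℝ => ∑ x ∈ B, ∑ κ : Fin d,
        (1 - nReTr ((gaugeAct (expGauge lam t) W x κ : (Matrix n n ℂ)ˣ) : Matrix n n ℂ))) 0 := by
      refine Filter.Eventually.of_forall fun t => ?_
      have e0 : gaugeAct (expGauge lam 0) W = W := by rw [expGauge_zero, gaugeAct_const_one]
      have et : gaugeAct (expGauge lam t) W = gaugeAct (v t) U := by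
        show gaugeAct (expGauge lam t) W = gaugeAct (expGauge lam t * u) U
        rw [gaugeAct_mul, ← hW]
      show (∑ x ∈ B, ∑ κ : Fin d, (1 - nReTr ((gaugeAct (expGauge lam 0) W x κ : (Matrix n n ℂ)ˣ) : Matrix n n ℂ)))
        ≤ ∑ x ∈ B, ∑ κ : Fin d, (1 - nReTr ((gaugeAct (expGauge lam t) W x κ : (Matrix n n ℂ)ˣ) : Matrix n n ℂ))
      rw [e0, et]
      exact hmin (v t) (hvu t) (hvQ t)
    have hder := hasDerivAt_traceLink_expGauge_finset B W lam
    have hzero := hlocmin.hasDerivAt_eq_zero hder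
    rw [neg_eq_zero] at hzero
    -- evaluate the sum: only the bonds at `y` and into `y` contribute
    have hsplit : ∑ x ∈ B, ∑ κ : Fin d,
        nReTr (lam x * ((W x κ : (Matrix n n ℂ)ˣ) : Matrix n n ℂ) - ((W x κ : (Matrix n n ℂ)ˣ) : Matrix n n ℂ) * lam (x + e κ))
        = ∑ κ : Fin d, (nReTr (X * ((W y κ : (Matrix n n ℂ)ˣ) : Matrix n n ℂ)) - nReTr (((W (y - e κ) κ : (Matrix n n ℂ)ˣ) : Matrix n n ℂ) * X)) := by
      rw [Finset.sum_comm]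
      refine Finset.sum_congr rfl fun κ _ => ?_
      have hA : ∀ x ∈ B, nReTr (lam x * ((W x κ : (Matrix n n ℂ)ˣ) : Matrix n n ℂ) - ((W x κ : (Matrix n n ℂ)ˣ) : Matrix n n ℂ) * lam (x + e κ))
          = (if y = x then nReTr (X * ((W x κ : (Matrix n n ℂ)ˣ) : Matrix n n ℂ)) else 0)
            - (if y - e κ = x then nReTr (((W x κ : (Matrix n n ℂ)ˣ) : Matrix n n ℂ) * X) else 0) := by
        intro x _
        have e1 : lam x = if y = x then X else 0 := by
          simp only [lam]; by_cases h : x = y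
          · rw [if_pos h, if_pos h.symm]
          · rw [if_neg h, if_neg (Ne.symm h)]
        have e2 : lam (x + e κ) = if y - e κ = x then X else 0 := by
          simp only [lam]
          by_cases h : y - e κ = x
          · rw [if_pos h, if_pos]; rw [← h, sub_add_cancel]
          · rw [if_neg h, if_neg]; intro h2; apply h; rw [← h2, add_sub_cancel_right]
        rw [e1, e2]
        unfold nReTr
        split_ifs <;> simp [Matrix.trace_sub, sub_div, neg_div]
      rw [Finset.sum_congr rfl hA, Finset.sum_sub_distrib, Finset.sum_ite_eq, Finset.sum_ite_eq, if_pos hyB, if_pos (hyB' κ)]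
    rw [hsplit] at hzero
    simp only [← NE3HessBounds.nReTr_mul_comm X] at hzero
    have : X * Dv = ∑ κ : Fin d, (X * ((W y κ : (Matrix n n ℂ)ˣ) : Matrix n n ℂ) - X * ((W (y - e κ) κ : (Matrix n n ℂ)ˣ) : Matrix n n ℂ)) := by
      simp only [hDv, Finset.mul_sum, mul_sub]
    rw [this]
    unfold nReTr at hzero ⊢
    rw [Matrix.trace_sum, Complex.re_sum, Finset.sum_div]
    simpa only [Matrix.trace_sub, Complex.sub_re, sub_div] using hzero
  have hD : Dv - Dvᴴ = 0 := nReTr_skew_eq_zero hfree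
  have hre : Dv - Dvᴴ = ∑ κ : Fin d, ((((W y κ : (Matrix n n ℂ)ˣ) : Matrix n n ℂ) - ((W y κ : (Matrix n n ℂ)ˣ) : Matrix n n ℂ)ᴴ)
      - (((W (y - e κ) κ : (Matrix n n ℂ)ˣ) : Matrix n n ℂ) - ((W (y - e κ) κ : (Matrix n n ℂ)ˣ) : Matrix n n ℂ)ᴴ)) := by
    simp only [hDv, Matrix.conjTranspose_sum, Matrix.conjTranspose_sub, ← Finset.sum_sub_distrib]
    refine Finset.sum_congr rfl fun κ _ => ?_
    abel
  rw [← hre]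
  exact hD

/-! ## §4 The Neumann lattice-Landau gauge on a finite set of sites -/

/-- **THE LATTICE LANDAU GAUGE ON A FINITE SET OF SITES EXISTS** (every `d`, every finite `Q`, every `U`): a site gauge `u`, unitary, `= 1` off `Q`, minimising the
trace link functional over the bonds based in `B := Q ∪ ⋃_κ (Q − e_κ)`, whose representative `W = U^{u}` satisfies the lattice Landau condition in Euler–Lagrange form at
EVERY site of `Q`.  The SUP letter of `W` is NOT claimed. [folklore] -/
theorem exists_cubeLandauGauge [Nonempty n] (Q : Finset (Site d)) (U : Site d → Fin d → (Matrix n n ℂ)ˣ) :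
    ∃ u : Site d → (Matrix n n ℂ)ˣ, (∀ x, u x ∈ unitaryUnits (Matrix n n ℂ)) ∧ (∀ x, x ∉ Q → u x = 1) ∧
      ∀ y ∈ Q, ∑ κ : Fin d, ((((gaugeAct u U y κ : (Matrix n n ℂ)ˣ) : Matrix n n ℂ) - ((gaugeAct u U y κ : (Matrix n n ℂ)ˣ) : Matrix n n ℂ)ᴴ)
        - (((gaugeAct u U (y - e κ) κ : (Matrix n n ℂ)ˣ) : Matrix n n ℂ) - ((gaugeAct u U (y - e κ) κ : (Matrix n n ℂ)ˣ) : Matrix n n ℂ)ᴴ)) = 0 := by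
  classical
  let B : Finset (Site d) := Q ∪ Finset.univ.biUnion fun κ : Fin d => Q.image fun x => x - e κ
  obtain ⟨u, hu, huQ, hmin⟩ := exists_cubeTraceLinkMinimiser B Q U
  refine ⟨u, hu, huQ, fun y hy => landau_of_isMin_cube B Q hu huQ hmin hy ?_ ?_⟩
  · exact Finset.mem_union_left _ hy
  · intro κ
    refine Finset.mem_union_right _ (Finset.mem_biUnion.mpr ⟨κ, Finset.mem_univ κ, Finset.mem_image.mpr ⟨y, hy, rfl⟩⟩)

end

end Summit.QuantumFields.BalabanUV.T4Continuum.NE7CubeLandauMinimiser
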